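import Literature.NumberTheory.Automorphic.Liu2021.Thm418Transport
import HarnessLib

/-!
# [Liu2021, Thm. 4.18 (2)] «mutually non-isomorphic» is invariant under isomorphism of the datum

Structural lemma, the ITEM-(2) SLICE of ✔ `Thm418Data.thm418AsPrinted_transport` (`Thm418Transport.lean`): if the summands `ω(μ, ε, χ)` of
`D : Thm418Data F E` over admissible indices are pairwise non-isomorphic `ℂ[𝔾(𝔸_F^∞)]`-modules (item (2) of [Liu2021, Thm. 4.18], l. 2241:
«The `ℂ[𝔾(𝔸_F^∞)]`-modules in the direct sum … are mutually non-isomorphic», typed `∀ i j, D.AreIsomorphic i j → i = j`), then so are those of any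
transported datum `D′ = D.transport G′ φ Eps′ epsOf′ Chi′ ω′ ρ′` along an INJECTIVE index map `e : D′.AdmIndex → D.AdmIndex` and summand isomorphisms
`ω′_{i′} ≃ₗ[ℂ] ω_{e i′}` intertwining `ρ′(g′)` with `ρ(φ g′)`.  Needed where item (2) alone is moved between two presentations of one datum (e.g.
the datum of a hermitian space `𝕍` at the label `μᶜ` read along `g ↦ ḡ` versus the conjugate space `𝕍^{(c)}` at `μ`), without the main
isomorphism or items (1), (3).  ONE THEOREM; no `def`, no named fact, no `sorry`; no mathematics of [Liu2021] is asserted.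
Seat prover-hodgecm-mathlib-A-p08 (cell hodgecm-mathlib, fan A, rung A-III, KEY a3-noniso-one-place), 2026-08-28.

References: [Liu2021] Y. Liu, *Fourier–Jacobi cycles and arithmetic relative trace formula*, Camb. J. Math. 9 (2021), Thm. 4.18 (2)
(FJcycle.tex l. 2241), Def. 4.11–4.12.
-/

set_option autoImplicit false

noncomputable section

open NumberField

namespace Literature.NumberTheory.Automorphic.Liu2021

namespace Thm418Data

variable {F E : Type} [Field F] [NumberField F] [IsTotallyReal F] [Field E] [NumberField E] [Algebra F E]
  [IsTotallyComplex E] [Algebra.IsQuadraticExtension F E]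

/-- **Item (2) of [Liu2021, Thm. 4.18] transports.**  For a datum `D` and its transport `D′ = D.transport G′ φ Eps′ epsOf′ Chi′ ω′ ρ′`, an INJECTIVE
index map `e : D′.AdmIndex → D.AdmIndex` and summand isomorphisms `Ωᵢ i′ : ω′_{i′} ≃ₗ[ℂ] ω_{e i′}` intertwining `ρ′(g′)` with `ρ(φ g′)`: if the summands
of `D` over admissible indices are pairwise non-isomorphic `ℂ[𝔾(𝔸_F^∞)]`-modules, so are those of `D′` — an isomorphism `ω′_{i′} ≃ ω′_{j′}` conjugates
to `ω_{e i′} ≃ ω_{e j′}`, equivariant because `φ` is onto. [cite: Liu2021, Thm. 4.18 (2) (l. 2241)] -/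
theorem nonIso_transport (D : Thm418Data F E) (G' : Type) [Group G'] [TopologicalSpace G'] [IsTopologicalGroup G']
    (φ : G' ≃ₜ* D.G) (Eps' : Type) (epsOf' : E → Eps') (Chi' : Type) (omega' : Eps' → Chi' → Type)
    [∀ ε χ, AddCommGroup (omega' ε χ)] [∀ ε χ, Module ℂ (omega' ε χ)]
    (rho' : ∀ ε χ, Representation ℂ G' (omega' ε χ))
    (e : (D.transport G' φ Eps' epsOf' Chi' omega' rho').AdmIndex → D.AdmIndex) (he : Function.Injective e)
    (Ωᵢ : ∀ i' : (D.transport G' φ Eps' epsOf' Chi' omega' rho').AdmIndex,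
      (D.transport G' φ Eps' epsOf' Chi' omega' rho').omegaAt i' ≃ₗ[ℂ] D.omegaAt (e i'))
    (hΩ : ∀ (i' : (D.transport G' φ Eps' epsOf' Chi' omega' rho').AdmIndex) (g' : G')
      (y : (D.transport G' φ Eps' epsOf' Chi' omega' rho').omegaAt i'),
      Ωᵢ i' ((D.transport G' φ Eps' epsOf' Chi' omega' rho').rhoAt i' g' y) = D.rhoAt (e i') (φ g') (Ωᵢ i' y))
    (h2 : ∀ i j : D.AdmIndex, D.AreIsomorphic i j → i = j) :
    ∀ i' j' : (D.transport G' φ Eps' epsOf' Chi' omega' rho').AdmIndex,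
      (D.transport G' φ Eps' epsOf' Chi' omega' rho').AreIsomorphic i' j' → i' = j' := by
  intro i' j' hij
  obtain ⟨f, hf⟩ := hij
  refine he (h2 (e i') (e j') ⟨((Ωᵢ i').symm.trans f).trans (Ωᵢ j'), fun g x => ?_⟩)
  -- `g = φ (φ⁻¹ g)`; then conjugate the three equivariances
  obtain ⟨g', rfl⟩ : ∃ g' : G', φ g' = g := ⟨φ.symm g, φ.apply_symm_apply g⟩
  have h1 : (Ωᵢ i').symm (D.rhoAt (e i') (φ g') x) =
      (D.transport G' φ Eps' epsOf' Chi' omega' rho').rhoAt i' g' ((Ωᵢ i').symm x) := by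
    apply (Ωᵢ i').injective
    rw [LinearEquiv.apply_symm_apply, hΩ, LinearEquiv.apply_symm_apply]
  simp only [LinearEquiv.trans_apply]
  rw [h1, hf, hΩ]

end Thm418Data

end Literature.NumberTheory.Automorphic.Liu2021

end
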